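import Summits.AtomisticToContinuum.HydrodynamicLimit.Theorems.BoxDissipativeWeakStrongEntropyAdmissibilityFineScaleBridge
import HarnessLib

/-!
# Crux `EntropyAdmissibility` (stmt-AtomisticToContinuum-9903) — the strategist's DECOMPOSITION and its glue (sorry-free)

Route `BoxDissipativeWeakStrong`, crux `EntropyAdmissibility` (`E_{P_N}[(A_N + B_N)⁺] → 0`: the clamp-renormalised local
entropy inequality of the box fields, in `L¹₊(P_N)`).  The live line (`Cruxes/EntropyAdmissibility/Lines/birth.lean`)
reduces the crux to S1b (`InFrame Cdef`, the inequality IN THE MEAN: eventually `E_{P_N}[A_N] + B ≤ ε`) AND S2a'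
(positive-time box concentration).  OBSERVATION (strategist, 2026-08-17): the route never needs the positive part.
The landed heart of `RelativeEnergyStability` (`RES.stub_clampedRelEnergyGronwall`, BF18 §3.2 in expectation) consumes
`EntropyAdmissibility` only through `E_{P_N}[max(K2f,0)] → 0` as Grönwall forcing, and the pathwise relative-energy
inequality (`RES.sx_pathwise`) is LINEAR in the entropy balance `K2f` before its final `le_max_left`; so the MEAN
inequality S1b drives the same Grönwall (forcing `max(0, E K2f)`), whence — with `FluxClosure` — the mean clamped box
relative energy vanishes at every `t < T`, whence (Step 1 of `RES.stub_clampedRelEnergyCoercive`) the box fields converge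
in `L¹(P_N ⊗ dx)` at every `t` (`InFrame Cptlgfs`), whence the crux AS TYPED by the landed `EABirthFS.crux_of_fineScaleLLN`
(determinism of the fine-scale limit makes the positive part free).  Hence the typed split

  `MeanLocalEntropyInequality → FluxClosure → MeanWeakStrongFineScale → EntropyAdmissibility`

with children (1) `MeanLocalEntropyInequality` = S1b verbatim (crux; the physics heart, NECESSARY for the crux by
`EABirthCore`), (2) `FluxClosure` = the route's other crux (item stmt-AtomisticToContinuum-9902, by name), (3)
`MeanWeakStrongFineScale` = the MEAN-form weak–strong stability at box scale (support; provable now by re-running the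
landed `RES` files with signed forcing).  This file proves the glue `entropyAdmissibility_of_subs` (pure logic over
`EABirthFS.crux_of_fineScaleLLN`), records that child (1) is implied by the crux, and that the children are definitionally
the frame statements `InFrame Cdef` / `InFrame Cptlgfs` of the line.  It replaces the line's S2a' (an open positive-time
LLN for deterministic dynamics) by `FluxClosure`, which the route must prove anyway.

References: J. Březina, E. Feireisl, J. Math. Soc. Japan 70 (2018) §3.2 (relative energy in the measure-valued
framework: the entropy inequality enters linearly); H. Spohn, Large Scale Dynamics of Interacting Particles (1991) I §3.
planner-cstrat-stmt-AtomisticToContinuum-9903-s1-0.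
-/

noncomputable section

open MeasureTheory Filter Set Function TopologicalSpace
open scoped ENNReal Topology BigOperators InnerProductSpace

namespace Summit.AtomisticToContinuum.HydrodynamicLimit.Theorems.EASplit

open Summit.AtomisticToContinuum.HydrodynamicLimit.Theses
open Summit.AtomisticToContinuum.HydrodynamicLimit.Theses.BoxDissipativeWeakStrong
open Summit.AtomisticToContinuum.HydrodynamicLimit.Theorems.EABirthCore (InFrame Cdef Ccrux)
open Summit.AtomisticToContinuum.HydrodynamicLimit.Theorems.EABirthFS3 (Cptlgfs)

/-- Child 1 IS the line's S1b `InFrame Cdef` and child 3's consequent IS `InFrame Cptlgfs` minus four vacuous binders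
(definitionally: `let`s ↦ `BDWS` objects): the three children give the positive-time fine-scale LLN in the crux's frame. -/
theorem inFrame_ptlgfs_of_subs
    (h₁ : (∃ η₀ : ℝ, 0 < η₀ ∧ ∃ F : ℝ → ℝ, AnalyticOnNhd ℝ F (Ioo (-η₀) η₀) ∧ EqOn Literature.MathematicalPhysics.KineticTheory.hsExcessFreeEnergy F (Ico 0 η₀) ∧ F 0 = 0 ∧ deriv F 0 = 2 * Real.pi / 3 ∧ ∀ η ∈ Ico 0 η₀, Tendsto (fun N : ℕ => -(N : ℝ)⁻¹ * Real.log (Literature.MathematicalPhysics.KineticTheory.hsFreeVolume η N)) atTop (𝓝 (F η))) → ∃ ηc : ℝ, 0 < ηc ∧ ∀ η₁ : ℝ, 0 < η₁ → η₁ < ηc → ∀ (a₀ θ₀ : Literature.MathematicalPhysics.KineticTheory.T3 → ℝ) (u₀ : Literature.MathematicalPhysics.KineticTheory.T3 → Literature.MathematicalPhysics.KineticTheory.V3), Continuous a₀ → Continuous θ₀ → Continuous u₀ → (∀ x, 0 < a₀ x) → (∀ x, 0 < θ₀ x) → ∃ σ₀ : ℝ, 0 < σ₀ ∧ ∀ σ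 : ℝ, 0 < σ → σ < σ₀ → ∀ (T : ℝ) (ρ θ : ℝ → Literature.MathematicalPhysics.KineticTheory.T3 → ℝ) (u : ℝ → Literature.MathematicalPhysics.KineticTheory.T3 → Literature.MathematicalPhysics.KineticTheory.V3), Literature.MathematicalPhysics.KineticTheory.IsHardSphereEulerSolution σ T ρ u θ → (∀ t ∈ Ico 0 T, ∀ x, ρ t x * σ ^ 3 ≤ η₁ / 2) → ∀ Φ : (N : ℕ) → Literature.Analysis.FluidPDE.HardSphereFlow (Literature.Analysis.FluidPDE.Torus.geometry (Fin 3)) (Literature.MathematicalPhysics.KineticTheory.hsDiameter σ N) (N + 1), Literature.MathematicalPhysics.KineticTheory.TendstoHydroFieldsAt (fun N => Literature.MathematicalPhysics.KineticTheory.localGibbsLaw σ a₀ u₀ θ₀ N (Φ N)) Φ ρ u θ 0 → ∀ ℓ : ℕ → ℝ, (∀ N, 0 < ℓ N ∧ ℓ N ≤ 1) → Tendsto ℓ atTop (𝓝 0) → Tendsto (fun N : ℕ => ℓ N ^ 3 * ((N : ℝ) + 1)) atTop atTop → let K := fun (l : ℝ) (x y : Literature.MathematicalPhysics.KineticTheory.T3)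 => indicator {y' : Literature.MathematicalPhysics.KineticTheory.T3 | ∀ i, ‖y' i - x i‖ < l / 2} (fun _ => (l ^ 3)⁻¹) y; let Dn := fun N t z x => Literature.MathematicalPhysics.KineticTheory.empiricalDensityField ((Φ N).flow t z) (K (ℓ N) x); let Mm := fun N t z x => Literature.MathematicalPhysics.KineticTheory.empiricalMomentumField ((Φ N).flow t z) (K (ℓ N) x); let En := fun N t z x => Literature.MathematicalPhysics.KineticTheory.empiricalEnergyField ((Φ N).flow t z) (K (ℓ N) x); let Th := fun (r : ℝ) (m : Literature.MathematicalPhysics.KineticTheory.V3) (E : ℝ) => 2 / 3 * (E / r - ‖m‖ ^ 2 / (2 * r ^ 2)); let Fc := fun η : ℝ => Literature.MathematicalPhysics.KineticTheory.hsExcessFreeEnergy (min η η₁) + (Literature.MathematicalPhysics.KineticTheory.hsCompressibility η₁ - 1) * Real.log (max η η₁ / η₁); let Sc := fun r ϑ : ℝ => 3 / 2 * Real.log ϑ - Real.log r - Fc (r * σ ^ 3); ∀ τ ∈ Ico 0 T, ∀ a b : ℝ, a < b → ∀ φ : ℝ → Literature.MathematicalPhysics.KineticTheory.T3 → ℝ,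 Literature.Analysis.FunctionSpaces.Torus.IsSmoothSpaceTimeOn (Ico 0 T) φ → (∀ t ∈ Icc 0 τ, ∀ x, 0 ≤ φ t x) → ∀ ε : ℝ, 0 < ε → ∀ᶠ N : ℕ in atTop, (∫ z, ((∫ t in Ioc 0 τ, ∫ x, (Dn N t z x * max a (min (Sc (Dn N t z x) (Th (Dn N t z x) (Mm N t z x) (En N t z x))) b) * Literature.Analysis.FunctionSpaces.Torus.timeDerivWithin (Ico 0 T) φ t x + max a (min (Sc (Dn N t z x) (Th (Dn N t z x) (Mm N t z x) (En N t z x))) b) * inner ℝ (Mm N t z x) (Literature.Analysis.FunctionSpaces.Torus.gradient (φ t) x))) - (∫ x, Dn N τ z x * max a (min (Sc (Dn N τ z x) (Th (Dn N τ z x) (Mm N τ z x) (En N τ z x))) b) * φ τ x)) ∂(Literature.MathematicalPhysics.KineticTheory.localGibbsLaw σ a₀ u₀ θ₀ N (Φ N))) + (∫ x, ρ 0 x * max a (min (Sc (ρ 0 x) (θ 0 x)) b) * φ 0 x) ≤ ε)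
    (h₂ : FluxClosure)
    (h₃ : FluxClosure → ((∃ η₀ : ℝ, 0 < η₀ ∧ ∃ F : ℝ → ℝ, AnalyticOnNhd ℝ F (Ioo (-η₀) η₀) ∧ EqOn Literature.MathematicalPhysics.KineticTheory.hsExcessFreeEnergy F (Ico 0 η₀) ∧ F 0 = 0 ∧ deriv F 0 = 2 * Real.pi / 3 ∧ ∀ η ∈ Ico 0 η₀, Tendsto (fun N : ℕ => -(N : ℝ)⁻¹ * Real.log (Literature.MathematicalPhysics.KineticTheory.hsFreeVolume η N)) atTop (𝓝 (F η))) → ∃ ηc : ℝ, 0 < ηc ∧ ∀ η₁ : ℝ, 0 < η₁ → η₁ < ηc → ∀ (a₀ θ₀ : Literature.MathematicalPhysics.KineticTheory.T3 → ℝ) (u₀ : Literature.MathematicalPhysics.KineticTheory.T3 → Literature.MathematicalPhysics.KineticTheory.V3), Continuous a₀ → Continuous θ₀ → Continuous u₀ → (∀ x, 0 < a₀ x) → (∀ x, 0 < θ₀ x) → ∃ σ₀ : ℝ, 0 < σ₀ ∧ ∀ σ : ℝ, 0 < σ → σ < σ₀ → ∀ (T : ℝ) (ρ θ : ℝ → Literature.MathematicalPhysics.KineticTheory.T3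 → ℝ) (u : ℝ → Literature.MathematicalPhysics.KineticTheory.T3 → Literature.MathematicalPhysics.KineticTheory.V3), Literature.MathematicalPhysics.KineticTheory.IsHardSphereEulerSolution σ T ρ u θ → (∀ t ∈ Ico 0 T, ∀ x, ρ t x * σ ^ 3 ≤ η₁ / 2) → ∀ Φ : (N : ℕ) → Literature.Analysis.FluidPDE.HardSphereFlow (Literature.Analysis.FluidPDE.Torus.geometry (Fin 3)) (Literature.MathematicalPhysics.KineticTheory.hsDiameter σ N) (N + 1), Literature.MathematicalPhysics.KineticTheory.TendstoHydroFieldsAt (fun N => Literature.MathematicalPhysics.KineticTheory.localGibbsLaw σ a₀ u₀ θ₀ N (Φ N)) Φ ρ u θ 0 → ∀ ℓ : ℕ → ℝ, (∀ N, 0 < ℓ N ∧ ℓ N ≤ 1) → Tendsto ℓ atTop (𝓝 0) → Tendsto (fun N : ℕ => ℓ N ^ 3 * ((N : ℝ) + 1)) atTop atTop → let K := fun (l : ℝ) (x y : Literature.MathematicalPhysics.KineticTheory.T3) => indicator {y' : Literature.MathematicalPhysics.KineticTheory.T3 | ∀ i, ‖y' i - x i‖ < l / 2} (fun _ => (l ^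 3)⁻¹) y; let Dn := fun N t z x => Literature.MathematicalPhysics.KineticTheory.empiricalDensityField ((Φ N).flow t z) (K (ℓ N) x); let Mm := fun N t z x => Literature.MathematicalPhysics.KineticTheory.empiricalMomentumField ((Φ N).flow t z) (K (ℓ N) x); let En := fun N t z x => Literature.MathematicalPhysics.KineticTheory.empiricalEnergyField ((Φ N).flow t z) (K (ℓ N) x); let Th := fun (r : ℝ) (m : Literature.MathematicalPhysics.KineticTheory.V3) (E : ℝ) => 2 / 3 * (E / r - ‖m‖ ^ 2 / (2 * r ^ 2)); let Fc := fun η : ℝ => Literature.MathematicalPhysics.KineticTheory.hsExcessFreeEnergy (min η η₁) + (Literature.MathematicalPhysics.KineticTheory.hsCompressibility η₁ - 1) * Real.log (max η η₁ / η₁); let Sc := fun r ϑ : ℝ => 3 / 2 * Real.log ϑ - Real.log r - Fc (r * σ ^ 3); ∀ τ ∈ Ico 0 T, ∀ a b : ℝ, a < b → ∀ φ : ℝ → Literature.MathematicalPhysics.KineticTheory.T3 → ℝ, Literature.Analysis.FunctionSpaces.Torus.IsSmoothSpaceTimeOn (Ico 0 T) φ → (∀ t ∈ Icc 0 τ, ∀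 x, 0 ≤ φ t x) → ∀ ε : ℝ, 0 < ε → ∀ᶠ N : ℕ in atTop, (∫ z, ((∫ t in Ioc 0 τ, ∫ x, (Dn N t z x * max a (min (Sc (Dn N t z x) (Th (Dn N t z x) (Mm N t z x) (En N t z x))) b) * Literature.Analysis.FunctionSpaces.Torus.timeDerivWithin (Ico 0 T) φ t x + max a (min (Sc (Dn N t z x) (Th (Dn N t z x) (Mm N t z x) (En N t z x))) b) * inner ℝ (Mm N t z x) (Literature.Analysis.FunctionSpaces.Torus.gradient (φ t) x))) - (∫ x, Dn N τ z x * max a (min (Sc (Dn N τ z x) (Th (Dn N τ z x) (Mm N τ z x) (En N τ z x))) b) * φ τ x)) ∂(Literature.MathematicalPhysics.KineticTheory.localGibbsLaw σ a₀ u₀ θ₀ N (Φ N))) + (∫ x, ρ 0 x * max a (min (Sc (ρ 0 x) (θ 0 x)) b) * φ 0 x) ≤ ε) → (∃ η₀ : ℝ, 0 < η₀ ∧ ∃ F : ℝ → ℝ, AnalyticOnNhd ℝ F (Ioo (-η₀) η₀) ∧ EqOn Literature.MathematicalPhysics.KineticTheory.hsExcessFreeEnergy F (Ico 0 η₀) ∧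 F 0 = 0 ∧ deriv F 0 = 2 * Real.pi / 3 ∧ ∀ η ∈ Ico 0 η₀, Tendsto (fun N : ℕ => -(N : ℝ)⁻¹ * Real.log (Literature.MathematicalPhysics.KineticTheory.hsFreeVolume η N)) atTop (𝓝 (F η))) → ∃ ηc : ℝ, 0 < ηc ∧ ∀ η₁ : ℝ, 0 < η₁ → η₁ < ηc → ∀ (a₀ θ₀ : Literature.MathematicalPhysics.KineticTheory.T3 → ℝ) (u₀ : Literature.MathematicalPhysics.KineticTheory.T3 → Literature.MathematicalPhysics.KineticTheory.V3), Continuous a₀ → Continuous θ₀ → Continuous u₀ → (∀ x, 0 < a₀ x) → (∀ x, 0 < θ₀ x) → ∃ σ₀ : ℝ, 0 < σ₀ ∧ ∀ σ : ℝ, 0 < σ → σ < σ₀ → ∀ (T : ℝ) (ρ θ : ℝ → Literature.MathematicalPhysics.KineticTheory.T3 → ℝ) (u : ℝ → Literature.MathematicalPhysics.KineticTheory.T3 → Literature.MathematicalPhysics.KineticTheory.V3), Literature.MathematicalPhysics.KineticTheory.IsHardSphereEulerSolution σ T ρ u θ → (∀ t ∈ Ico 0 T, ∀ x, ρ t x *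 σ ^ 3 ≤ η₁ / 2) → ∀ Φ : (N : ℕ) → Literature.Analysis.FluidPDE.HardSphereFlow (Literature.Analysis.FluidPDE.Torus.geometry (Fin 3)) (Literature.MathematicalPhysics.KineticTheory.hsDiameter σ N) (N + 1), Literature.MathematicalPhysics.KineticTheory.TendstoHydroFieldsAt (fun N => Literature.MathematicalPhysics.KineticTheory.localGibbsLaw σ a₀ u₀ θ₀ N (Φ N)) Φ ρ u θ 0 → ∀ ℓ : ℕ → ℝ, (∀ N, 0 < ℓ N ∧ ℓ N ≤ 1) → Tendsto ℓ atTop (𝓝 0) → Tendsto (fun N : ℕ => ℓ N ^ 3 * ((N : ℝ) + 1)) atTop atTop → let K := fun (l : ℝ) (x y : Literature.MathematicalPhysics.KineticTheory.T3) => indicator {y' : Literature.MathematicalPhysics.KineticTheory.T3 | ∀ i, ‖y' i - x i‖ < l / 2} (fun _ => (l ^ 3)⁻¹) y; let Dn := fun N t z x => Literature.MathematicalPhysics.KineticTheory.empiricalDensityField ((Φ N).flow t z) (K (ℓ N) x); let Mm := fun N t z x => Literature.MathematicalPhysics.KineticTheory.empiricalMomentumField ((Φ N).flow t z) (K (ℓ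 N) x); let En := fun N t z x => Literature.MathematicalPhysics.KineticTheory.empiricalEnergyField ((Φ N).flow t z) (K (ℓ N) x); ∀ t ∈ Ico 0 T, Tendsto (fun N : ℕ => ∫⁻ z, ENNReal.ofReal (∫ x, (|Dn N t z x - ρ t x| + ‖Mm N t z x - ρ t x • u t x‖ + |En N t z x - Literature.MathematicalPhysics.KineticTheory.totalEnergyDensity (ρ t x) (u t x) (θ t x)|)) ∂(Literature.MathematicalPhysics.KineticTheory.localGibbsLaw σ a₀ u₀ θ₀ N (Φ N))) atTop (𝓝 0)) :
    InFrame Cptlgfs := by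
  intro hE
  obtain ⟨ηc, hηc, H⟩ := h₃ h₂ h₁ hE
  refine ⟨ηc, hηc, fun η₁ hη₁ hη₁c a₀ θ₀ u₀ ha hθ hu ha0 hθ0 => ?_⟩
  obtain ⟨σ₀, hσ₀, H₂⟩ := H η₁ hη₁ hη₁c a₀ θ₀ u₀ ha hθ hu ha0 hθ0
  refine ⟨σ₀, hσ₀, fun σ hσ hσσ₀ T ρ θ u hsol hguard Φ hLLN ℓ hℓ hℓ0 hℓ3 τ _hτ a b _hab φ _hφ _hφ0 => ?_⟩
  exact H₂ σ hσ hσσ₀ T ρ θ u hsol hguard Φ hLLN ℓ hℓ hℓ0 hℓ3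

/-- **THE GLUE of the split (sorry-free): child 1 → child 2 (`FluxClosure`) → child 3 → the crux BY NAME**, by the landed
`EABirthFS.crux_of_fineScaleLLN` (the crux holds along any flow family with the box-scale hydrodynamic limit at every
`t < T`).  The three antecedents are VERBATIM the child statements filed with `route edit --split` (child 1 = S1b =
`InFrame Cdef` definitionally; child 2 = the route item `FluxClosure` by name; child 3 = the mean-form weak–strong stability
at box scale), so the term is a direct application. -/
theorem entropyAdmissibility_of_subs :
    ((∃ η₀ : ℝ, 0 < η₀ ∧ ∃ F : ℝ → ℝ, AnalyticOnNhd ℝ F (Ioo (-η₀) η₀) ∧ EqOn Literature.MathematicalPhysics.KineticTheory.hsExcessFreeEnergy F (Ico 0 η₀) ∧ F 0 = 0 ∧ deriv F 0 = 2 * Real.pi / 3 ∧ ∀ η ∈ Ico 0 η₀, Tendsto (fun N : ℕ => -(N : ℝ)⁻¹ * Real.log (Literature.MathematicalPhysics.KineticTheory.hsFreeVolume η N)) atTop (𝓝 (F η))) → ∃ ηc : ℝ, 0 < ηc ∧ ∀ η₁ : ℝ, 0 < η₁ → η₁ < ηc → ∀ (a₀ θ₀ : Literature.MathematicalPhysics.KineticTheory.T3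 → ℝ) (u₀ : Literature.MathematicalPhysics.KineticTheory.T3 → Literature.MathematicalPhysics.KineticTheory.V3), Continuous a₀ → Continuous θ₀ → Continuous u₀ → (∀ x, 0 < a₀ x) → (∀ x, 0 < θ₀ x) → ∃ σ₀ : ℝ, 0 < σ₀ ∧ ∀ σ : ℝ, 0 < σ → σ < σ₀ → ∀ (T : ℝ) (ρ θ : ℝ → Literature.MathematicalPhysics.KineticTheory.T3 → ℝ) (u : ℝ → Literature.MathematicalPhysics.KineticTheory.T3 → Literature.MathematicalPhysics.KineticTheory.V3), Literature.MathematicalPhysics.KineticTheory.IsHardSphereEulerSolution σ T ρ u θ → (∀ t ∈ Ico 0 T, ∀ x, ρ t x * σ ^ 3 ≤ η₁ / 2) → ∀ Φ : (N : ℕ) → Literature.Analysis.FluidPDE.HardSphereFlow (Literature.Analysis.FluidPDE.Torus.geometry (Fin 3)) (Literature.MathematicalPhysics.KineticTheory.hsDiameter σ N) (N + 1), Literature.MathematicalPhysics.KineticTheory.TendstoHydroFieldsAt (fun N => Literature.MathematicalPhysics.KineticTheory.localGibbsLaw σ a₀ u₀ θ₀ N (Φ N)) Φ ρ u θ 0 →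 ∀ ℓ : ℕ → ℝ, (∀ N, 0 < ℓ N ∧ ℓ N ≤ 1) → Tendsto ℓ atTop (𝓝 0) → Tendsto (fun N : ℕ => ℓ N ^ 3 * ((N : ℝ) + 1)) atTop atTop → let K := fun (l : ℝ) (x y : Literature.MathematicalPhysics.KineticTheory.T3) => indicator {y' : Literature.MathematicalPhysics.KineticTheory.T3 | ∀ i, ‖y' i - x i‖ < l / 2} (fun _ => (l ^ 3)⁻¹) y; let Dn := fun N t z x => Literature.MathematicalPhysics.KineticTheory.empiricalDensityField ((Φ N).flow t z) (K (ℓ N) x); let Mm := fun N t z x => Literature.MathematicalPhysics.KineticTheory.empiricalMomentumField ((Φ N).flow t z) (K (ℓ N) x); let En := fun N t z x => Literature.MathematicalPhysics.KineticTheory.empiricalEnergyField ((Φ N).flow t z) (K (ℓ N) x); let Th := fun (r : ℝ) (m : Literature.MathematicalPhysics.KineticTheory.V3) (E : ℝ) => 2 / 3 * (E / r - ‖m‖ ^ 2 / (2 * r ^ 2)); let Fc := fun η : ℝ => Literature.MathematicalPhysics.KineticTheory.hsExcessFreeEnergy (min η η₁) + (Literature.MathematicalPhysics.KineticTheory.hsCompressibility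 η₁ - 1) * Real.log (max η η₁ / η₁); let Sc := fun r ϑ : ℝ => 3 / 2 * Real.log ϑ - Real.log r - Fc (r * σ ^ 3); ∀ τ ∈ Ico 0 T, ∀ a b : ℝ, a < b → ∀ φ : ℝ → Literature.MathematicalPhysics.KineticTheory.T3 → ℝ, Literature.Analysis.FunctionSpaces.Torus.IsSmoothSpaceTimeOn (Ico 0 T) φ → (∀ t ∈ Icc 0 τ, ∀ x, 0 ≤ φ t x) → ∀ ε : ℝ, 0 < ε → ∀ᶠ N : ℕ in atTop, (∫ z, ((∫ t in Ioc 0 τ, ∫ x, (Dn N t z x * max a (min (Sc (Dn N t z x) (Th (Dn N t z x) (Mm N t z x) (En N t z x))) b) * Literature.Analysis.FunctionSpaces.Torus.timeDerivWithin (Ico 0 T) φ t x + max a (min (Sc (Dn N t z x) (Th (Dn N t z x) (Mm N t z x) (En N t z x))) b) * inner ℝ (Mm N t z x) (Literature.Analysis.FunctionSpaces.Torus.gradient (φ t) x))) - (∫ x, Dn N τ z x * max a (min (Sc (Dn N τ z x) (Th (Dn N τ z x) (Mm N τ z x) (En N τ z x))) b) * φ τ x)) ∂(Literature.MathematicalPhysics.KineticTheory.localGibbsLaw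 σ a₀ u₀ θ₀ N (Φ N))) + (∫ x, ρ 0 x * max a (min (Sc (ρ 0 x) (θ 0 x)) b) * φ 0 x) ≤ ε) →
    FluxClosure →
    (FluxClosure → ((∃ η₀ : ℝ, 0 < η₀ ∧ ∃ F : ℝ → ℝ, AnalyticOnNhd ℝ F (Ioo (-η₀) η₀) ∧ EqOn Literature.MathematicalPhysics.KineticTheory.hsExcessFreeEnergy F (Ico 0 η₀) ∧ F 0 = 0 ∧ deriv F 0 = 2 * Real.pi / 3 ∧ ∀ η ∈ Ico 0 η₀, Tendsto (fun N : ℕ => -(N : ℝ)⁻¹ * Real.log (Literature.MathematicalPhysics.KineticTheory.hsFreeVolume η N)) atTop (𝓝 (F η))) → ∃ ηc : ℝ, 0 < ηc ∧ ∀ η₁ : ℝ, 0 < η₁ → η₁ < ηc → ∀ (a₀ θ₀ : Literature.MathematicalPhysics.KineticTheory.T3 → ℝ) (u₀ : Literature.MathematicalPhysics.KineticTheory.T3 → Literature.MathematicalPhysics.KineticTheory.V3), Continuous a₀ → Continuous θ₀ → Continuous u₀ → (∀ x, 0 < a₀ x) → (∀ x, 0 < θ₀ x) → ∃ σ₀ :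 ℝ, 0 < σ₀ ∧ ∀ σ : ℝ, 0 < σ → σ < σ₀ → ∀ (T : ℝ) (ρ θ : ℝ → Literature.MathematicalPhysics.KineticTheory.T3 → ℝ) (u : ℝ → Literature.MathematicalPhysics.KineticTheory.T3 → Literature.MathematicalPhysics.KineticTheory.V3), Literature.MathematicalPhysics.KineticTheory.IsHardSphereEulerSolution σ T ρ u θ → (∀ t ∈ Ico 0 T, ∀ x, ρ t x * σ ^ 3 ≤ η₁ / 2) → ∀ Φ : (N : ℕ) → Literature.Analysis.FluidPDE.HardSphereFlow (Literature.Analysis.FluidPDE.Torus.geometry (Fin 3)) (Literature.MathematicalPhysics.KineticTheory.hsDiameter σ N) (N + 1), Literature.MathematicalPhysics.KineticTheory.TendstoHydroFieldsAt (fun N => Literature.MathematicalPhysics.KineticTheory.localGibbsLaw σ a₀ u₀ θ₀ N (Φ N)) Φ ρ u θ 0 → ∀ ℓ : ℕ → ℝ, (∀ N, 0 < ℓ N ∧ ℓ N ≤ 1) → Tendsto ℓ atTop (𝓝 0) → Tendsto (fun N : ℕ => ℓ N ^ 3 * ((N : ℝ) + 1)) atTop atTop → let K := fun (l : ℝ)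 (x y : Literature.MathematicalPhysics.KineticTheory.T3) => indicator {y' : Literature.MathematicalPhysics.KineticTheory.T3 | ∀ i, ‖y' i - x i‖ < l / 2} (fun _ => (l ^ 3)⁻¹) y; let Dn := fun N t z x => Literature.MathematicalPhysics.KineticTheory.empiricalDensityField ((Φ N).flow t z) (K (ℓ N) x); let Mm := fun N t z x => Literature.MathematicalPhysics.KineticTheory.empiricalMomentumField ((Φ N).flow t z) (K (ℓ N) x); let En := fun N t z x => Literature.MathematicalPhysics.KineticTheory.empiricalEnergyField ((Φ N).flow t z) (K (ℓ N) x); let Th := fun (r : ℝ) (m : Literature.MathematicalPhysics.KineticTheory.V3) (E : ℝ) => 2 / 3 * (E / r - ‖m‖ ^ 2 / (2 * r ^ 2)); let Fc := fun η : ℝ => Literature.MathematicalPhysics.KineticTheory.hsExcessFreeEnergy (min η η₁) + (Literature.MathematicalPhysics.KineticTheory.hsCompressibility η₁ - 1) * Real.log (max η η₁ / η₁); let Sc := fun r ϑ : ℝ => 3 / 2 * Real.log ϑ - Real.log r - Fc (r * σ ^ 3); ∀ τ ∈ Ico 0 T, ∀ a b : ℝ, a < b → ∀ φ : ℝ → Literature.MathematicalPhysics.KineticTheory.T3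 → ℝ, Literature.Analysis.FunctionSpaces.Torus.IsSmoothSpaceTimeOn (Ico 0 T) φ → (∀ t ∈ Icc 0 τ, ∀ x, 0 ≤ φ t x) → ∀ ε : ℝ, 0 < ε → ∀ᶠ N : ℕ in atTop, (∫ z, ((∫ t in Ioc 0 τ, ∫ x, (Dn N t z x * max a (min (Sc (Dn N t z x) (Th (Dn N t z x) (Mm N t z x) (En N t z x))) b) * Literature.Analysis.FunctionSpaces.Torus.timeDerivWithin (Ico 0 T) φ t x + max a (min (Sc (Dn N t z x) (Th (Dn N t z x) (Mm N t z x) (En N t z x))) b) * inner ℝ (Mm N t z x) (Literature.Analysis.FunctionSpaces.Torus.gradient (φ t) x))) - (∫ x, Dn N τ z x * max a (min (Sc (Dn N τ z x) (Th (Dn N τ z x) (Mm N τ z x) (En N τ z x))) b) * φ τ x)) ∂(Literature.MathematicalPhysics.KineticTheory.localGibbsLaw σ a₀ u₀ θ₀ N (Φ N))) + (∫ x, ρ 0 x * max a (min (Sc (ρ 0 x) (θ 0 x)) b) * φ 0 x) ≤ ε) → (∃ η₀ : ℝ, 0 < η₀ ∧ ∃ F : ℝ → ℝ, AnalyticOnNhd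 ℝ F (Ioo (-η₀) η₀) ∧ EqOn Literature.MathematicalPhysics.KineticTheory.hsExcessFreeEnergy F (Ico 0 η₀) ∧ F 0 = 0 ∧ deriv F 0 = 2 * Real.pi / 3 ∧ ∀ η ∈ Ico 0 η₀, Tendsto (fun N : ℕ => -(N : ℝ)⁻¹ * Real.log (Literature.MathematicalPhysics.KineticTheory.hsFreeVolume η N)) atTop (𝓝 (F η))) → ∃ ηc : ℝ, 0 < ηc ∧ ∀ η₁ : ℝ, 0 < η₁ → η₁ < ηc → ∀ (a₀ θ₀ : Literature.MathematicalPhysics.KineticTheory.T3 → ℝ) (u₀ : Literature.MathematicalPhysics.KineticTheory.T3 → Literature.MathematicalPhysics.KineticTheory.V3), Continuous a₀ → Continuous θ₀ → Continuous u₀ → (∀ x, 0 < a₀ x) → (∀ x, 0 < θ₀ x) → ∃ σ₀ : ℝ, 0 < σ₀ ∧ ∀ σ : ℝ, 0 < σ → σ < σ₀ → ∀ (T : ℝ) (ρ θ : ℝ → Literature.MathematicalPhysics.KineticTheory.T3 → ℝ) (u : ℝ → Literature.MathematicalPhysics.KineticTheory.T3 → Literature.MathematicalPhysics.KineticTheory.V3),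 Literature.MathematicalPhysics.KineticTheory.IsHardSphereEulerSolution σ T ρ u θ → (∀ t ∈ Ico 0 T, ∀ x, ρ t x * σ ^ 3 ≤ η₁ / 2) → ∀ Φ : (N : ℕ) → Literature.Analysis.FluidPDE.HardSphereFlow (Literature.Analysis.FluidPDE.Torus.geometry (Fin 3)) (Literature.MathematicalPhysics.KineticTheory.hsDiameter σ N) (N + 1), Literature.MathematicalPhysics.KineticTheory.TendstoHydroFieldsAt (fun N => Literature.MathematicalPhysics.KineticTheory.localGibbsLaw σ a₀ u₀ θ₀ N (Φ N)) Φ ρ u θ 0 → ∀ ℓ : ℕ → ℝ, (∀ N, 0 < ℓ N ∧ ℓ N ≤ 1) → Tendsto ℓ atTop (𝓝 0) → Tendsto (fun N : ℕ => ℓ N ^ 3 * ((N : ℝ) + 1)) atTop atTop → let K := fun (l : ℝ) (x y : Literature.MathematicalPhysics.KineticTheory.T3) => indicator {y' : Literature.MathematicalPhysics.KineticTheory.T3 | ∀ i, ‖y' i - x i‖ < l / 2} (fun _ => (l ^ 3)⁻¹) y; let Dn := fun N t z x => Literature.MathematicalPhysics.KineticTheory.empiricalDensityField ((Φ N).flow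 t z) (K (ℓ N) x); let Mm := fun N t z x => Literature.MathematicalPhysics.KineticTheory.empiricalMomentumField ((Φ N).flow t z) (K (ℓ N) x); let En := fun N t z x => Literature.MathematicalPhysics.KineticTheory.empiricalEnergyField ((Φ N).flow t z) (K (ℓ N) x); ∀ t ∈ Ico 0 T, Tendsto (fun N : ℕ => ∫⁻ z, ENNReal.ofReal (∫ x, (|Dn N t z x - ρ t x| + ‖Mm N t z x - ρ t x • u t x‖ + |En N t z x - Literature.MathematicalPhysics.KineticTheory.totalEnergyDensity (ρ t x) (u t x) (θ t x)|)) ∂(Literature.MathematicalPhysics.KineticTheory.localGibbsLaw σ a₀ u₀ θ₀ N (Φ N))) atTop (𝓝 0)) →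
    BoxDissipativeWeakStrong.EntropyAdmissibility :=
  fun h₁ h₂ h₃ => EABirthFS.crux_of_fineScaleLLN (inFrame_ptlgfs_of_subs h₁ h₂ h₃)

end Summit.AtomisticToContinuum.HydrodynamicLimit.Theorems.EASplit

end
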